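import Literature.RingTheory.NoetherNormalization.LinearChange
import Mathlib.RingTheory.IntegralClosure.IsIntegralClosure.Basic
import Mathlib.Algebra.Polynomial.Lifts
import Mathlib.Data.Fintype.EquivFin
import HarnessLib

/-!
# Noether normalisation by LINEAR changes of finitely many generators

Topic `Literature/RingTheory/NoetherNormalization` (namespace
`Literature.RingTheory.NoetherNormalization`), continuing `LinearChange.lean` (the single
quantitative shear). Classical statement (Greuel–Pfister, *A Singular Introduction to Commutative
Algebra* (2002), Thm. 3.4.1, over an infinite field): if an algebra `A` over an infinite field `k`
is integral over `k[y_0, …, y_N]` and the `y_i` satisfy a nonzero polynomial relation, then after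
a linear change `y_i' = y_{i+1} - v_i y_0` (`v_i ∈ k`) the algebra `A` is integral over
`k[y_1', …, y_N']`; iterating, `A` becomes integral over the subalgebra generated by `r` elements
of the `k`-SPAN of the original generators as soon as any `r + 1` elements of that span are
algebraically dependent. This is the form of Noether normalisation in which the new generators are
LINEAR combinations of the old ones, needed when degrees must be controlled (e.g. Jelonek's proof
of the effective Nullstellensatz, `Literature/RingTheory/Nullstellensatz/`). Mathlib's
`Mathlib.RingTheory.NoetherNormalization` uses Nagata's non-linear substitution instead.

## Contents (everything proved)

* `isIntegral_of_isIntegral_adjoin` — transitivity in the form used: if every element of `S` is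
  integral over a subalgebra `B'` and `a` is integral over `k[S]`, then `a` is integral over `B'`;
* `aeval_finCons_eq_aevalTower_finSuccEquiv` — evaluating `F(y_0, y')` through
  `finSuccEquiv : k[X_0, …, X_N] ≃ k[X_1, …, X_N][X_0]`;
* `exists_shear_isIntegral` — **one normalisation step**: a nonzero relation `F(y) = 0` yields
  `v ∈ kᴺ` with `y_0` integral over `k[y_1 - v_1 y_0, …, y_N - v_N y_0]`;
* `exists_linear_noether_normalization` — **the iteration**: `r` elements of `span_k {y_i}` over
  whose subalgebra `A` is integral, given that any `r + 1` elements of the span are dependent.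

## References

* G.-M. Greuel, G. Pfister, *A Singular Introduction to Commutative Algebra*, Springer (2002),
  Thm. 3.4.1 and its proof (case of an infinite field). [GreuelPfister2002]
-/

noncomputable section

open MvPolynomial Polynomial

namespace Literature.RingTheory.NoetherNormalization

variable {k : Type*} [Field k] {A : Type*} [CommRing A] [Algebra k A]

/-! ### Integrality over adjoined subalgebras -/

/-- Every element of a subalgebra is integral over it. [folklore] -/
theorem isIntegral_of_mem_subalgebra {B : Subalgebra k A} {a : A} (ha : a ∈ B) :
    IsIntegral B a :=
  isIntegral_algebraMap (R := B) (A := A) (x := ⟨a, ha⟩)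

/-- If every element of `S` is integral over the subalgebra `B'`, so is every element of `k[S]`
(the integral closure of `B'` in `A` is a `k`-subalgebra containing `S`). [folklore] -/
theorem isIntegral_of_mem_adjoin_of_forall_isIntegral {B' : Subalgebra k A} {S : Set A}
    (hS : ∀ s ∈ S, IsIntegral B' s) {x : A} (hx : x ∈ Algebra.adjoin k S) : IsIntegral B' x := by
  have hle : Algebra.adjoin k S ≤ (integralClosure B' A).restrictScalars k :=
    Algebra.adjoin_le fun s hs => (mem_integralClosure_iff _ _).2 (hS s hs)
  exact (mem_integralClosure_iff _ _).1 (hle hx)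

/-- **Transitivity of integrality between adjoined subalgebras**: if every element of `S` is
integral over the subalgebra `B'` and `a` is integral over `k[S]`, then `a` is integral over `B'`
(the coefficients of an integral equation of `a` over `k[S]` generate a subalgebra `R₁` integral
over `B'`, and `a` is integral over `R₁`). [folklore] -/
theorem isIntegral_of_isIntegral_adjoin {B' : Subalgebra k A} {S : Set A}
    (hS : ∀ s ∈ S, IsIntegral B' s) {a : A}
    (ha : IsIntegral (Algebra.adjoin k S) a) : IsIntegral B' a := by
  obtain ⟨p, hp, hpa⟩ := ha
  -- the integral equation, with coefficients in `A`
  set p' : A[X] := p.map (algebraMap (Algebra.adjoin k S) A) with hp'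
  have hp'm : p'.Monic := hp.map _
  have hp'a : p'.eval a = 0 := by rw [hp', Polynomial.eval_map]; exact hpa
  have hcoeff : ∀ j, IsIntegral B' (p'.coeff j) := fun j => by
    rw [hp', Polynomial.coeff_map]
    exact isIntegral_of_mem_adjoin_of_forall_isIntegral hS (p.coeff j).2
  -- the subalgebra generated by the coefficients
  let T : Set A := Set.range fun j : Fin (p'.natDegree + 1) => p'.coeff j
  let R₁ : Subalgebra B' A := Algebra.adjoin B' T
  haveI : Algebra.IsIntegral B' R₁ :=
    Algebra.IsIntegral.adjoin (by rintro _ ⟨j, rfl⟩; exact hcoeff j)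
  -- `p'` lifts to a monic polynomial over `R₁`
  have hlifts : p' ∈ Polynomial.lifts (algebraMap R₁ A) := by
    rw [lifts_iff_coeff_lifts]
    intro j
    by_cases hj : j ≤ p'.natDegree
    · exact ⟨⟨p'.coeff j, Algebra.subset_adjoin ⟨⟨j, Nat.lt_succ_of_le hj⟩, rfl⟩⟩, rfl⟩
    · exact ⟨0, by rw [map_zero, coeff_eq_zero_of_natDegree_lt (not_le.1 hj)]⟩
  obtain ⟨q, hq, -, hqm⟩ := lifts_and_natDegree_eq_and_monic hlifts hp'm
  have hqa : IsIntegral R₁ a := by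
    refine ⟨q, hqm, ?_⟩
    rw [← Polynomial.eval_map, hq]
    exact hp'a
  exact isIntegral_trans a hqa

/-! ### Evaluation through `finSuccEquiv` -/

/-- `F(y_0, y_1, …, y_N) = (finSuccEquiv F)(y_0)` where the coefficients, polynomials in
`X_1, …, X_N`, are evaluated at `(y_1, …, y_N)`. [folklore] -/
theorem aeval_finCons_eq_aevalTower_finSuccEquiv {N : ℕ} (y₀ : A) (y : Fin N → A)
    (F : MvPolynomial (Fin (N + 1)) k) :
    aeval (Fin.cons y₀ y : Fin (N + 1) → A) F =
      aevalTower (aeval y : MvPolynomial (Fin N) k →ₐ[k] A) y₀ (finSuccEquiv k N F) := by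
  change aeval (Fin.cons y₀ y : Fin (N + 1) → A) F =
    ((aevalTower (aeval y : MvPolynomial (Fin N) k →ₐ[k] A) y₀).comp
      (finSuccEquiv k N).toAlgHom) F
  congr 1
  refine MvPolynomial.algHom_ext fun i => ?_
  refine Fin.cases ?_ (fun j => ?_) i
  · simp [finSuccEquiv_X_zero]
  · simp [finSuccEquiv_X_succ]

/-! ### One normalisation step -/

section Step

variable [Infinite k]

/-- **One step of linear Noether normalisation** (Greuel–Pfister 2002, proof of Thm. 3.4.1 (5)):
if `y_0, …, y_N ∈ A` (an algebra over an infinite field) satisfy a nonzero relation `F(y) = 0`,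
then for suitable `v ∈ kᴺ` the element `y_0` is integral over `k[y_1 - v_1 y_0, …, y_N - v_N y_0]`
(after the shear `X_{i+1} ↦ X_{i+1} + v_i X_0` and a scaling, `F` becomes monic in `X_0`;
`exists_linearChange_monic`). [cite: GreuelPfister2002, Thm. 3.4.1 (proof)] -/
theorem exists_shear_isIntegral {N : ℕ} (y : Fin (N + 1) → A) {F : MvPolynomial (Fin (N + 1)) k}
    (hF : F ≠ 0) (hFy : aeval y F = 0) :
    ∃ v : Fin N → k, IsIntegral
      (Algebra.adjoin k (Set.range fun i : Fin N => y i.succ - v i • y 0)) (y 0) := by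
  obtain ⟨S, hS⟩ := Infinite.exists_subset_card_eq k (F.totalDegree + 1)
  obtain ⟨v, -, c, -, hmonic, -⟩ := exists_linearChange_monic hF S (by omega)
  refine ⟨v, ?_⟩
  set y' : Fin N → A := fun i => y i.succ - v i • y 0 with hy'
  set B' : Subalgebra k A := Algebra.adjoin k (Set.range y') with hB'
  -- the generators `y'` inside `B'`
  let w : Fin N → B' := fun i => ⟨y' i, Algebra.subset_adjoin ⟨i, rfl⟩⟩
  let φ : MvPolynomial (Fin N) k →ₐ[k] B' := aeval w
  have hφ : (algebraMap B' A).comp (φ : MvPolynomial (Fin N) k →+* B') =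
      (aeval y' : MvPolynomial (Fin N) k →ₐ[k] A).toRingHom := by
    have h : ((Algebra.ofId B' A).restrictScalars k).comp φ = MvPolynomial.aeval y' := by
      refine MvPolynomial.algHom_ext fun i => ?_
      simp [φ, w]
    exact congrArg AlgHom.toRingHom h
  set G := finSuccEquiv k N (linearChange v (MvPolynomial.C c * F)) with hG
  refine ⟨G.map (φ : MvPolynomial (Fin N) k →+* B'), hmonic.map _, ?_⟩
  rw [Polynomial.eval₂_map, hφ]
  change aevalTower (aeval y' : MvPolynomial (Fin N) k →ₐ[k] A) (y 0) G = 0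
  rw [hG, ← aeval_finCons_eq_aevalTower_finSuccEquiv]
  -- undo the shear: `X_0 ↦ y_0`, `X_{i+1} + v_i X_0 ↦ y'_i + v_i y_0 = y_{i+1}`
  have hcomp : (MvPolynomial.aeval (Fin.cons (y 0) y' : Fin (N + 1) → A)).comp (linearChange v) =
      MvPolynomial.aeval y := by
    refine MvPolynomial.algHom_ext fun i => ?_
    refine Fin.cases ?_ (fun j => ?_) i
    · simp
    · rw [AlgHom.comp_apply, linearChange_X_succ, map_add, map_mul, MvPolynomial.aeval_X,
        MvPolynomial.aeval_X, MvPolynomial.aeval_X, MvPolynomial.algHom_C, Fin.cons_succ,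
        Fin.cons_zero, Algebra.algebraMap_eq_smul_one, smul_mul_assoc, one_mul, hy']
      simp only [sub_add_cancel]
  have := congrArg (fun g : MvPolynomial (Fin (N + 1)) k →ₐ[k] A => g (MvPolynomial.C c * F)) hcomp
  simp only [AlgHom.comp_apply] at this
  rw [this, map_mul, hFy, mul_zero]

end Step

/-! ### The iteration -/

section Iteration

variable [Infinite k]

/-- **Linear Noether normalisation of a finite family.** Let `A` be an algebra over an infinite
field `k`, integral over `k[y_0, …, y_{M-1}]`, and let `r ≤ M` be such that any `r + 1` elements
of the `k`-span of the `y_i` are algebraically dependent over `k`. Then there are `r` elements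
`L_1, …, L_r` of that span such that `A` is integral over `k[L_1, …, L_r]` (Greuel–Pfister 2002,
Thm. 3.4.1, infinite-field case, iterated; the `L_j` are obtained from the `y_i` by successive
shears `y_{i+1} - v_i y_0`). [cite: GreuelPfister2002, Thm. 3.4.1] -/
theorem exists_linear_noether_normalization (r : ℕ) :
    ∀ (M : ℕ) (y : Fin M → A), r ≤ M →
      (∀ a : A, IsIntegral (Algebra.adjoin k (Set.range y)) a) →
      (∀ w : Fin (r + 1) → A, (∀ i, w i ∈ Submodule.span k (Set.range y)) →
        ∃ F : MvPolynomial (Fin (r + 1)) k, F ≠ 0 ∧ aeval w F = 0) →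
      ∃ L : Fin r → A, (∀ j, L j ∈ Submodule.span k (Set.range y)) ∧
        ∀ a : A, IsIntegral (Algebra.adjoin k (Set.range L)) a := by
  intro M y hrM
  induction M, hrM using Nat.le_induction with
  | base =>
    intro hint _
    exact ⟨y, fun j => Submodule.subset_span ⟨j, rfl⟩, hint⟩
  | succ N hrN ih =>
    intro hint hdep
    -- a nonzero relation among `y_0, …, y_N` (from one among the first `r + 1` of them)
    have hle : r + 1 ≤ N + 1 := by omega
    obtain ⟨F₀, hF₀, hF₀y⟩ := hdep (fun i => y (Fin.castLE hle i))
      (fun i => Submodule.subset_span (Set.mem_range_self (Fin.castLE hle i)))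
    set F := rename (Fin.castLE hle) F₀ with hF
    have hFne : F ≠ 0 := fun h => hF₀ (rename_injective _ (Fin.castLE_injective hle) (by
      rw [← hF, h, map_zero]))
    have hFy : aeval y F = 0 := by rw [hF, aeval_rename]; exact hF₀y
    -- the shear
    obtain ⟨v, hv⟩ := exists_shear_isIntegral y hFne hFy
    set y' : Fin N → A := fun i => y i.succ - v i • y 0 with hy'
    -- every `y_i`, hence all of `A`, is integral over `k[y']`
    have hspan' : ∀ i, y' i ∈ Submodule.span k (Set.range y) := fun i =>
      Submodule.sub_mem _ (Submodule.subset_span (Set.mem_range_self (f := y) i.succ))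
        (Submodule.smul_mem _ _ (Submodule.subset_span (Set.mem_range_self (f := y) 0)))
    have hyint : ∀ i, IsIntegral (Algebra.adjoin k (Set.range y')) (y i) := by
      intro i
      refine Fin.cases hv (fun j => ?_) i
      have : y j.succ = y' j + v j • y 0 := by simp [hy']
      rw [this]
      exact (isIntegral_of_mem_subalgebra
        (Algebra.subset_adjoin (Set.mem_range_self (f := y') j))).add (hv.smul _)
    have hint' : ∀ a : A, IsIntegral (Algebra.adjoin k (Set.range y')) a := fun a =>
      isIntegral_of_isIntegral_adjoin (by rintro _ ⟨i, rfl⟩; exact hyint i) (hint a)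
    have hsub : Submodule.span k (Set.range y') ≤ Submodule.span k (Set.range y) :=
      Submodule.span_le.2 (by rintro _ ⟨i, rfl⟩; exact hspan' i)
    obtain ⟨L, hL, hLint⟩ := ih y' hint' (fun w hw => hdep w fun i => hsub (hw i))
    exact ⟨L, fun j => hsub (hL j), hLint⟩

end Iteration

end Literature.RingTheory.NoetherNormalization

end
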